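import Mathlib
import HarnessLib
import Literature.Probability.MarkovChains.CountingBound
import Literature.Probability.MarkovChains.OptimalCoupling

/-!
# Markovian couplings and the coupling bound `‖Pᵗ(x,·) − Pᵗ(y,·)‖_TV ≤ P_{x,y}{X_t ≠ Y_t}` (Levin–Peres–Wilmer §5.1–5.2, Thm. 5.4, Cor. 5.5)

HONEST FRAMING: exact (Metropolis-corrected) sampling algorithms for lattice gauge theory; figures
of merit are autocorrelation/cost numbers at stated couplings and volumes; no continuum-physics claim.

Conventions of `TotalVariation.lean` (`tvDist`, `IsRowStochastic`), `MixingTimeSubmultiplicative.lean`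
(`kernelAt P t x y = Pᵗ(x,y)`, `worstPairTvDist P t = d̄(t)`, Lemma 4.10), `BottleneckRatio.lean`
(`worstTvDist P π t = d(t)`, `mixingTime`), `ContractionSpectralGap.lean` (`IsCoupling`) and
`OptimalCoupling.lean` (Prop. 4.7: `‖μ − ν‖_TV ≤ P{X ≠ Y}` for every coupling).  A coupling of two
copies of the chain is encoded by its JOINT TRANSITION KERNEL `Q` on `X × X`; the law of
`(X_t, Y_t)` started from `(x,y)` is the row `Qᵗ((x,y),·) = kernelAt Q t (x,y)`, and
`P_{x,y}{X_t ≠ Y_t} = Σ_a Σ_{b ≠ a} Qᵗ((x,y),(a,b))`.  Source: D. A. Levin, Y. Peres (with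
E. L. Wilmer), *Markov Chains and Mixing Times*, 2nd ed., AMS 2017 [LevinPeres2017], §5.1–§5.2,
pp. 61–62.  Everything is PROVED (finite sums; 0 named facts).

* `IsMarkovianCoupling P Q` — **§5.1**: a MARKOVIAN COUPLING of two `P`-chains is a Markov chain on
  `X × X` with `P{X_{t+1} = x' | X_t = x, Y_t = y} = P(x,x')` and
  `P{Y_{t+1} = y' | X_t = x, Y_t = y} = P(y,y')`, i.e. every row `Q((x,y),·)` is a coupling of
  `P(x,·)` and `P(y,·)` [cite: LevinPeres2017, §5.1 (definition of a Markovian coupling, the two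
  displayed identities)]; `isMarkovianCoupling_indep` (independent moves);
  `IsMarkovianCoupling.isRowStochastic`;
* `isMarkovianCoupling_kernelAt` — **"`(X_t,Y_t)` is a coupling of `Pᵗ(x,·)` with `Pᵗ(y,·)`"**:
  `Qᵗ` is a Markovian coupling of `Pᵗ` [cite: LevinPeres2017, §5.2 Thm. 5.4 (proof, first two
  sentences: "`Pᵗ(x,z) = P_{x,y}{X_t = z}` and `Pᵗ(y,z) = P_{x,y}{Y_t = z}`")];
* **THEOREM 5.4 in the form (5.5)** `LevinPeres2017_thm_5_4` —
  **`‖Pᵗ(x,·) − Pᵗ(y,·)‖_TV ≤ P_{x,y}{X_t ≠ Y_t}`** for every Markovian coupling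
  [cite: LevinPeres2017, §5.2 Thm. 5.4, eq. (5.5)].  (The book's (5.4) replaces the right side by
  `P_{x,y}{τ_couple > t}` for couplings satisfying (5.2); for such "sticky" couplings the two events
  coincide.  Here (5.2) is `IsSticky Q` — from a diagonal state the coupling moves to a diagonal
  state — and its kernel-level consequence `IsMarkovianCoupling.offDiag_succ_le`:
  `P_{x,y}{X_{t+1} ≠ Y_{t+1}} ≤ P_{x,y}{X_t ≠ Y_t}` [cite: LevinPeres2017, §5.1 eq. (5.2), §5.2
  eq. (5.3)–(5.4)]; the stopping time `τ_couple` itself is not introduced.)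
* **COROLLARY 5.5** `LevinPeres2017_cor_5_5` — if for each pair `x, y` there is a Markovian coupling
  with `P_{x,y}{X_t ≠ Y_t} ≤ B`, then **`d(t) ≤ B`** (via `d(t) ≤ d̄(t)`, Lemma 4.10), and
  `LevinPeres2017_cor_5_5_mixingTime` — hence `t_mix(ε) ≤ t` when `B ≤ ε` [cite: LevinPeres2017,
  §5.2 Cor. 5.5].  (The clause "`t_mix ≤ 4 max E τ_couple`", Markov's inequality for the stopping
  time, is not restated.)

Context (cell pub-lqcd, venture LatticeQCDFlow): coupling arguments (e.g. for single-site heat-bath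
dynamics at high temperature, or for toy models such as the hypercube walk of §5.3.1) bound `t_mix`
through exactly this inequality.
-/

namespace Literature.Probability.MarkovChains

open Finset

variable {X : Type*} [Fintype X] [DecidableEq X]

/-- **§5.1: MARKOVIAN COUPLING.**  A joint transition kernel `Q` on `X × X` is a Markovian coupling
of two `P`-chains if each row `Q((x,y),·)` is a coupling of `P(x,·)` and `P(y,·)`:
`Σ_{y'} Q((x,y),(x',y')) = P(x,x')`, `Σ_{x'} Q((x,y),(x',y')) = P(y,y')`, `Q ≥ 0`.
[cite: LevinPeres2017, §5.1 (definition of a Markovian coupling)] -/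
def IsMarkovianCoupling (P : X → X → ℝ) (Q : X × X → X × X → ℝ) : Prop :=
  ∀ x y : X, IsCoupling (P x) (P y) (fun a b => Q (x, y) (a, b))

/-- **Eq. (5.2)** ("if `X_s = Y_s`, then `X_t = Y_t` for `t ≥ s`") for a Markovian coupling: from a
diagonal state the joint kernel only moves to diagonal states. [cite: LevinPeres2017, §5.1
eq. (5.2)] -/
def IsSticky (Q : X × X → X × X → ℝ) : Prop :=
  ∀ z a b : X, a ≠ b → Q (z, z) (a, b) = 0

section Basic

variable {P : X → X → ℝ} {Q : X × X → X × X → ℝ}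

omit [DecidableEq X] in
/-- `Q ≥ 0`. [cite: LevinPeres2017, §5.1 (definition of a Markovian coupling)] -/
theorem IsMarkovianCoupling.nonneg (hQ : IsMarkovianCoupling P Q) (p q : X × X) : 0 ≤ Q p q :=
  (hQ p.1 p.2).1 q.1 q.2

omit [DecidableEq X] in
/-- `Σ_{y'} Q((x,y),(x',y')) = P(x,x')`. [cite: LevinPeres2017, §5.1 (first displayed identity)] -/
theorem IsMarkovianCoupling.sum_right (hQ : IsMarkovianCoupling P Q) (x y a : X) :
    ∑ b, Q (x, y) (a, b) = P x a :=
  (hQ x y).2.1 a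

omit [DecidableEq X] in
/-- `Σ_{x'} Q((x,y),(x',y')) = P(y,y')`. [cite: LevinPeres2017, §5.1 (second displayed identity)] -/
theorem IsMarkovianCoupling.sum_left (hQ : IsMarkovianCoupling P Q) (x y b : X) :
    ∑ a, Q (x, y) (a, b) = P y b :=
  (hQ x y).2.2 b

omit [DecidableEq X] in
/-- A Markovian coupling of a stochastic `P` is a stochastic matrix on `X × X`.
[cite: LevinPeres2017, §5.1 ("a Markov chain with state space `X × X`")] -/
theorem IsMarkovianCoupling.isRowStochastic (hQ : IsMarkovianCoupling P Q) (hP : IsRowStochastic P) :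
    IsRowStochastic Q := by
  refine ⟨hQ.nonneg, fun p => ?_⟩
  rw [Fintype.sum_prod_type]
  simp_rw [show ∀ a, ∑ b, Q p (a, b) = P p.1 a from fun a => hQ.sum_right p.1 p.2 a]
  exact hP.2 p.1

omit [DecidableEq X] in
/-- The two chains moved independently, `Q((x,y),(x',y')) = P(x,x')P(y,y')`, form a Markovian
coupling. [cite: LevinPeres2017, §4.2 Example 4.6 (i) with §5.1] -/
theorem isMarkovianCoupling_indep (hP : IsRowStochastic P) :
    IsMarkovianCoupling P (fun p q => P p.1 q.1 * P p.2 q.2) :=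
  fun x y => isCoupling_mul (hP.1 x) (hP.1 y) (hP.2 x) (hP.2 y)

end Basic

section Bound

variable {P : X → X → ℝ} {Q : X × X → X × X → ℝ} {π : X → ℝ}

/-- **`(X_t, Y_t)` is a coupling of `Pᵗ(x,·)` with `Pᵗ(y,·)`**: the `t`-step kernel of a Markovian
coupling is a Markovian coupling of `Pᵗ` (`Pᵗ(x,z) = P_{x,y}{X_t = z}`, `Pᵗ(y,z) = P_{x,y}{Y_t = z}`).
[cite: LevinPeres2017, §5.2 Thm. 5.4 (proof, first two sentences)] -/
theorem isMarkovianCoupling_kernelAt (hQ : IsMarkovianCoupling P Q) :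
    ∀ t : ℕ, IsMarkovianCoupling (kernelAt P t) (kernelAt Q t) := by
  intro t
  induction t with
  | zero =>
    intro x y
    refine ⟨fun a b => ?_, fun a => ?_, fun b => ?_⟩
    · show 0 ≤ kernelAt Q 0 (x, y) (a, b)
      rw [kernelAt_zero_apply]
      split_ifs <;> norm_num
    · show ∑ b, kernelAt Q 0 (x, y) (a, b) = kernelAt P 0 x a
      simp_rw [kernelAt_zero_apply, Prod.mk.injEq]
      by_cases hax : a = x
      · simp [hax]
      · simp [hax]
    · show ∑ a, kernelAt Q 0 (x, y) (a, b) = kernelAt P 0 y b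
      simp_rw [kernelAt_zero_apply, Prod.mk.injEq]
      by_cases hby : b = y
      · simp [hby]
      · simp [hby]
  | succ t ih =>
    intro x y
    refine ⟨fun a b => ?_, fun a => ?_, fun b => ?_⟩
    · show 0 ≤ kernelAt Q (t + 1) (x, y) (a, b)
      rw [kernelAt_succ_apply]
      exact sum_nonneg fun r _ => mul_nonneg ((ih x y).1 r.1 r.2) (hQ.nonneg r _)
    · show ∑ b, kernelAt Q (t + 1) (x, y) (a, b) = kernelAt P (t + 1) x a
      calc ∑ b, kernelAt Q (t + 1) (x, y) (a, b)
          = ∑ b, ∑ c, ∑ d, kernelAt Q t (x, y) (c, d) * Q (c, d) (a, b) := by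
            refine sum_congr rfl fun b _ => ?_
            rw [kernelAt_succ_apply, Fintype.sum_prod_type]
        _ = ∑ c, ∑ d, kernelAt Q t (x, y) (c, d) * ∑ b, Q (c, d) (a, b) := by
            rw [sum_comm]
            refine sum_congr rfl fun c _ => ?_
            rw [sum_comm]
            refine sum_congr rfl fun d _ => ?_
            rw [mul_sum]
        _ = ∑ c, (∑ d, kernelAt Q t (x, y) (c, d)) * P c a := by
            refine sum_congr rfl fun c _ => ?_
            rw [sum_mul]
            exact sum_congr rfl fun d _ => by rw [hQ.sum_right c d a]
        _ = ∑ c, kernelAt P t x c * P c a :=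
            sum_congr rfl fun c _ => by rw [(ih x y).2.1 c]
        _ = kernelAt P (t + 1) x a := (kernelAt_succ_apply P t x a).symm
    · show ∑ a, kernelAt Q (t + 1) (x, y) (a, b) = kernelAt P (t + 1) y b
      calc ∑ a, kernelAt Q (t + 1) (x, y) (a, b)
          = ∑ a, ∑ c, ∑ d, kernelAt Q t (x, y) (c, d) * Q (c, d) (a, b) := by
            refine sum_congr rfl fun a _ => ?_
            rw [kernelAt_succ_apply, Fintype.sum_prod_type]
        _ = ∑ c, ∑ d, kernelAt Q t (x, y) (c, d) * ∑ a, Q (c, d) (a, b) := by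
            rw [sum_comm]
            refine sum_congr rfl fun c _ => ?_
            rw [sum_comm]
            refine sum_congr rfl fun d _ => ?_
            rw [mul_sum]
        _ = ∑ d, (∑ c, kernelAt Q t (x, y) (c, d)) * P d b := by
            rw [sum_comm]
            refine sum_congr rfl fun d _ => ?_
            rw [sum_mul]
            exact sum_congr rfl fun c _ => by rw [hQ.sum_left c d b]
        _ = ∑ d, kernelAt P t y d * P d b :=
            sum_congr rfl fun d _ => by rw [(ih x y).2.2 d]
        _ = kernelAt P (t + 1) y b := (kernelAt_succ_apply P t y b).symm

/-- **THEOREM 5.4, eq. (5.5)**: for every Markovian coupling of two `P`-chains started at `(x,y)`,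
**`‖Pᵗ(x,·) − Pᵗ(y,·)‖_TV ≤ P_{x,y}{X_t ≠ Y_t} = Σ_a Σ_{b ≠ a} Qᵗ((x,y),(a,b))`** (Prop. 4.7
applied to the coupling `(X_t,Y_t)` of `Pᵗ(x,·)` and `Pᵗ(y,·)`).  For a coupling satisfying (5.2) the
right side is `P_{x,y}{τ_couple > t}` (eq. (5.4)). [cite: LevinPeres2017, §5.2 Thm. 5.4,
eqs. (5.4)–(5.5)] -/
theorem LevinPeres2017_thm_5_4 (hQ : IsMarkovianCoupling P Q) (t : ℕ) (x y : X) :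
    tvDist (kernelAt P t x) (kernelAt P t y) ≤ ∑ a, ∑ b ∈ univ.erase a, kernelAt Q t (x, y) (a, b) :=
  LevinPeres2017_prop_4_7_le (isMarkovianCoupling_kernelAt hQ t x y)

/-- Under (5.2) the disagreement probability is non-increasing in `t`:
`P_{x,y}{X_{t+1} ≠ Y_{t+1}} ≤ P_{x,y}{X_t ≠ Y_t}` (the events `{X_t ≠ Y_t} = {τ_couple > t}`
decrease). [cite: LevinPeres2017, §5.1 eq. (5.2) with §5.2 eq. (5.3) ("`P_{x,y}{X_t ≠ Y_t} =
P_{x,y}{τ_couple > t}`")] -/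
theorem IsMarkovianCoupling.offDiag_succ_le (hQ : IsMarkovianCoupling P Q) (hP : IsRowStochastic P)
    (hS : IsSticky Q) (t : ℕ) (x y : X) :
    ∑ a, ∑ b ∈ univ.erase a, kernelAt Q (t + 1) (x, y) (a, b) ≤
      ∑ a, ∑ b ∈ univ.erase a, kernelAt Q t (x, y) (a, b) := by
  have hQs : IsRowStochastic Q := hQ.isRowStochastic hP
  have hK0 : ∀ r, 0 ≤ kernelAt Q t (x, y) r := (kernelAt_isRowStochastic hQs t).1 (x, y)
  -- the one-step disagreement mass out of `r`: `D(r) = Σ_a Σ_{b ≠ a} Q(r,(a,b))`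
  have hD1 : ∀ r : X × X, ∑ a, ∑ b ∈ univ.erase a, Q r (a, b) ≤ 1 := fun r =>
    calc ∑ a, ∑ b ∈ univ.erase a, Q r (a, b) ≤ ∑ a, ∑ b, Q r (a, b) :=
          sum_le_sum fun a _ => sum_le_sum_of_subset_of_nonneg (erase_subset _ _)
            fun b _ _ => hQs.1 r (a, b)
      _ = 1 := by rw [← Fintype.sum_prod_type]; exact hQs.2 r
  have hD0 : ∀ c : X, ∑ a, ∑ b ∈ univ.erase a, Q (c, c) (a, b) = 0 := fun c =>
    sum_eq_zero fun a _ => sum_eq_zero fun b hb => hS c a b (Ne.symm (ne_of_mem_erase hb))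
  -- expand the last step and exchange the sums
  have hL : ∑ a, ∑ b ∈ univ.erase a, kernelAt Q (t + 1) (x, y) (a, b) =
      ∑ r, kernelAt Q t (x, y) r * ∑ a, ∑ b ∈ univ.erase a, Q r (a, b) := by
    simp_rw [kernelAt_succ_apply, mul_sum]
    rw [sum_comm]
    exact sum_congr rfl fun a _ => sum_comm
  rw [hL, Fintype.sum_prod_type]
  refine sum_le_sum fun c _ => ?_
  rw [← sum_erase_add _ _ (mem_univ c), hD0 c, mul_zero, add_zero]
  exact sum_le_sum fun d _ => by
    simpa only [mul_one] using mul_le_mul_of_nonneg_left (hD1 (c, d)) (hK0 (c, d))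

/-- **COROLLARY 5.5**: if for each pair of states `x, y` there is a Markovian coupling started from
`(x,y)` with `P_{x,y}{X_t ≠ Y_t} ≤ B`, then **`d(t) ≤ B`** (Theorem 5.4 with Lemma 4.10,
`d(t) ≤ d̄(t)`). [cite: LevinPeres2017, §5.2 Cor. 5.5] -/
theorem LevinPeres2017_cor_5_5 [Nonempty X] (hπ : IsStationary π P) (hπ0 : ∀ x, 0 ≤ π x)
    (hπ1 : ∑ x, π x = 1) {t : ℕ} {B : ℝ}
    (h : ∀ x y : X, ∃ Q : X × X → X × X → ℝ, IsMarkovianCoupling P Q ∧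
      ∑ a, ∑ b ∈ univ.erase a, kernelAt Q t (x, y) (a, b) ≤ B) :
    worstTvDist P π t ≤ B := by
  have hpair : ∀ x y : X, tvDist (kernelAt P t x) (kernelAt P t y) ≤ B := fun x y => by
    obtain ⟨Q, hQ, hB⟩ := h x y
    exact (LevinPeres2017_thm_5_4 hQ t x y).trans hB
  have hB0 : 0 ≤ B := by
    obtain ⟨x⟩ := ‹Nonempty X›
    exact (tvDist_nonneg _ _).trans (hpair x x)
  refine (worstTvDist_le_worstPairTvDist hπ hπ0 hπ1 t).trans ?_
  exact Real.iSup_le (fun p => hpair p.1 p.2) hB0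

/-- **COROLLARY 5.5 (mixing-time form)**: if for each pair `x, y` some Markovian coupling has
`P_{x,y}{X_t ≠ Y_t} ≤ ε`, then `t_mix(ε) ≤ t`. [cite: LevinPeres2017, §5.2 Cor. 5.5 (with §4.5
eq. (4.30))] -/
theorem LevinPeres2017_cor_5_5_mixingTime [Nonempty X] (hπ : IsStationary π P) (hπ0 : ∀ x, 0 ≤ π x)
    (hπ1 : ∑ x, π x = 1) {t : ℕ} {ε : ℝ}
    (h : ∀ x y : X, ∃ Q : X × X → X × X → ℝ, IsMarkovianCoupling P Q ∧
      ∑ a, ∑ b ∈ univ.erase a, kernelAt Q t (x, y) (a, b) ≤ ε) :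
    mixingTime P π ε ≤ t :=
  mixingTime_le P π (LevinPeres2017_cor_5_5 hπ hπ0 hπ1 h)

end Bound

end Literature.Probability.MarkovChains
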